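import Summits.BirchSwinnertonDyer.BirchSwinnertonDyer.Theorems.ManinLocalTwoThreeGenerationOfHeckeCokernel
import Literature.NumberTheory.EllipticCurves.LFunctionPrimeCoeff
import Literature.NumberTheory.EllipticCurves.ModularityVersionApProofs
import HarnessLib

/-!
# Route `ManinLocalTwoThree`, crux C3 `ManinPrimeToThreeAtNine` (stmt-BirchSwinnertonDyer-22968): the `𝔫_f` glue —
# from the LINE-FACING homological E-es-25 (`EsG9Typed.RelativeIharaCokernelOfCurve 3 3 1`, body verbatim) to the
# Hecke-cokernel hypothesis and to E-es-19's shift classes, per (globally minimal) curve (line prover p3)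

The homological currency of the cell's relative Ihara statement speaks of a maximal ideal `𝔫 ⊂ 𝕋̃ = ℤ[T_r : r ∤ 3N]`
with `3 ∈ 𝔫` BELONGING to a globally minimal `W₀` (`T_r − a_r(W₀) ∈ 𝔫` off `N_{W₀}·3`). For the newform `f` of `W₀`
this file builds that ideal: the INTEGER eigencharacter `s ↦ λ_f(s)` of `𝕋̃` on a rational newform
(`exists_int_eigenvalue_of_mem_primeTo`, by induction over `ℤ[T_r]` from `T_r f = a_r(W) f`, `a_r(W) ∈ ℤ`), the ring map
`χ_f : 𝕋̃ → 𝔽₃` it defines inside the proof, `ker χ_f` maximal (`𝔽₃` is a field and `χ_f` is onto), `3 ∈ ker χ_f`, and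
belonging by `a_r(f) = a_r(W₀)` at the good primes (`LFunction_apply_prime_eq_frobeniusTrace`,
`dvd_conductorNorm_iff_not_hasGoodReductionAtPrime`). Output: the hypothesis shape of the landed
`shiftClassGenerationThree_of_hecke_cokernel` for THAT curve (`exists_hecke_cokernel_three_of_relativeIharaCokernelOfCurve`),
and from it the instance of E-es-19's body for that curve (`shiftClasses_of_hecke_cokernel`). Restricted to globally
minimal `W` (the crux's curves are); conditional on the quoted body; nothing about BSD or Manin is proved here.
-/

set_option autoImplicit false
set_option linter.dupNamespace false

noncomputable section

open scoped MatrixGroups BigOperators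

open CongruenceSubgroup Literature.NumberTheory.EllipticCurves.ModularForms

namespace Summit.BirchSwinnertonDyer.BirchSwinnertonDyer.Theorems.ManinLocalTwoThree

open scoped Classical ModularForm
open Matrix.SpecialLinearGroup ModularGroup Literature.NumberTheory.EllipticCurves
  Summit.BirchSwinnertonDyer.Rank1Residual.ManinAdditive

/-- **Integer eigenvalues of `𝕋̃` on a rational newform.** For the newform `f` of `W` and `s ∈ 𝕋̃ = ℤ[T_r : r ∤ S]`
there is `c ∈ ℤ` with `s f = c f` (generators: `T_r f = a_r(W) f`; closed under `ℤ`, `+`, `·`). [folklore] -/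
theorem exists_int_eigenvalue_of_mem_primeTo {W : WeierstrassCurve ℚ} {N : ℕ} [NeZero N]
    {f : CuspForm (Gamma0 N) 2} (hf : IsNewformOf W f) (S : ℕ) {s : HeckeRing0 N 2}
    (hs : s ∈ HeckeRing0.primeTo N 2 S) :
    ∃ c : ℤ, HeckeRing0.toEnd N 2 s f = (c : ℂ) • f := by
  change s ∈ Algebra.adjoin ℤ _ at hs
  induction hs using Algebra.adjoin_induction with
  | mem x hx =>
    obtain ⟨r, hr, -, rfl⟩ := hx
    haveI : NeZero r := ⟨hr.ne_zero⟩
    refine ⟨W.LFunction r, ?_⟩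
    rw [HeckeRing0.toEnd_T, hf.1.heckeT_eq_coeff_smul hr]
    exact congrArg (· • f) (hf.2 r)
  | algebraMap n =>
    refine ⟨n, ?_⟩
    rw [Algebra.algebraMap_eq_smul_one, map_zsmul, map_one, LinearMap.smul_apply, Module.End.one_apply,
      Int.cast_smul_eq_zsmul]
  | add x y _ _ hx hy =>
    obtain ⟨c₁, h₁⟩ := hx
    obtain ⟨c₂, h₂⟩ := hy
    refine ⟨c₁ + c₂, ?_⟩
    rw [map_add, LinearMap.add_apply, h₁, h₂, Int.cast_add, add_smul]
  | mul x y _ _ hx hy =>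
    obtain ⟨c₁, h₁⟩ := hx
    obtain ⟨c₂, h₂⟩ := hy
    refine ⟨c₁ * c₂, ?_⟩
    rw [map_mul, Module.End.mul_apply, h₂, map_smul, h₁, smul_smul, Int.cast_mul, mul_comm]

/-- A newform is nonzero (`a_1(f) = 1`). [folklore] -/
theorem IsNewformOf.ne_zero {W : WeierstrassCurve ℚ} {N : ℕ} [NeZero N] {f : CuspForm (Gamma0 N) 2}
    (hf : IsNewformOf W f) : f ≠ 0 := by
  intro h0
  have h1 : cuspCoeff f 1 = 1 := hf.1.2.2
  rw [h0, cuspCoeff, CuspForm.coe_zero, UpperHalfPlane.qExpansion_zero, map_zero] at h1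
  exact zero_ne_one h1

/-- **The `𝔫_f` glue (p = 3, globally minimal curve).** From the body of `EsG9Typed.RelativeIharaCokernelOfCurve 3 3 1`
(VERBATIM as `h`): for a globally minimal `W` with `W[3]` irreducible and its newform `f` of level `N`, some `s ∈ 𝕋_ℤ`
with `s f = m f`, `3 ∤ m`, has `s · H₁(X₀(N), ℤ) ⊆ (ι₃^∨ − ι₁^∨) H₁(X₀(3N), ℤ)` — the hypothesis shape of
`shiftClassGenerationThree_of_hecke_cokernel` for that curve. The maximal ideal fed to `h` is `ker(χ_f : 𝕋̃ → 𝔽₃)`,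
`χ_f(s) = λ_f(s) mod 3`. [folklore] -/
theorem exists_hecke_cokernel_three_of_relativeIharaCokernelOfCurve
    (h : ∀ (W₀ : WeierstrassCurve ℚ) [W₀.IsElliptic] [W₀.IsGloballyMinimal], W₀.HasIrreducibleModPGaloisRep 3 →
      ∀ (N d L : ℕ) [NeZero N] [NeZero d] [NeZero L], (3 : ℕ).Prime → (3 : ℕ).Prime → 1 ≤ 1 → d = 3 ^ 1 →
        L = d * N →
        ∀ 𝔫 : Ideal (HeckeRing0.primeTo N 2 (3 * N)), 𝔫.IsMaximal →
          (3 : HeckeRing0.primeTo N 2 (3 * N)) ∈ 𝔫 →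
          (∀ (r : ℕ) (hr : r.Prime) (hrS : ¬ r ∣ 3 * N), ¬ r ∣ W₀.conductorNorm ℤ * 3 →
            HeckeRing0.primeTo.T N 2 (3 * N) hr hrS -
              (W₀.frobeniusTrace r : HeckeRing0.primeTo N 2 (3 * N)) ∈ 𝔫) →
          ∃ s : HeckeRing0.primeTo N 2 (3 * N), s ∉ 𝔫 ∧
            ∀ x ∈ periodHomology N, ∃ z ∈ periodHomology L,
              (degeneracyMap0 N L d 2).dualMap z - (degeneracyMap0 N L 1 2).dualMap z =
                (s : HeckeRing0 N 2) • x)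
    (W : WeierstrassCurve ℚ) [W.IsElliptic] [W.IsGloballyMinimal] (hirr : W.HasIrreducibleModPGaloisRep 3)
    {N : ℕ} [NeZero N] (f : CuspForm (Gamma0 N) 2) (hf : IsNewformOf W f) :
    ∃ (s : HeckeRing0 N 2) (m : ℤ), ¬ (3 : ℤ) ∣ m ∧ HeckeRing0.toEnd N 2 s f = (m : ℂ) • f ∧
      ∀ x ∈ periodHomology N, ∃ z ∈ periodHomology (3 * N),
        (degeneracyMap0 N (3 * N) 3 2).dualMap z - (degeneracyMap0 N (3 * N) 1 2).dualMap z = s • x := by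
  haveI : NeZero (3 * N) := ⟨Nat.mul_ne_zero (by norm_num) (NeZero.ne N)⟩
  have hf0 : f ≠ 0 := IsNewformOf.ne_zero hf
  -- the integer eigencharacter `lam` of `𝕋̃` on `f`
  have hev : ∀ s : HeckeRing0.primeTo N 2 (3 * N), ∃ c : ℤ,
      HeckeRing0.toEnd N 2 (s : HeckeRing0 N 2) f = (c : ℂ) • f :=
    fun s => exists_int_eigenvalue_of_mem_primeTo hf (3 * N) s.2
  choose lam hlam using hev
  have huniq : ∀ (s : HeckeRing0.primeTo N 2 (3 * N)) (c : ℤ),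
      HeckeRing0.toEnd N 2 (s : HeckeRing0 N 2) f = (c : ℂ) • f → lam s = c := by
    intro s c hc
    have h1 : ((lam s : ℂ)) • f = (c : ℂ) • f := by rw [← hlam s, hc]
    exact_mod_cast smul_left_injective ℂ hf0 h1
  let lamHom : HeckeRing0.primeTo N 2 (3 * N) →+* ℤ :=
    { toFun := lam
      map_one' := huniq 1 1 (by rw [OneMemClass.coe_one, map_one, Module.End.one_apply, Int.cast_one, one_smul])
      map_mul' := fun s s' => huniq (s * s') (lam s * lam s') (by
        rw [Subalgebra.coe_mul, map_mul, Module.End.mul_apply, hlam s', map_smul, hlam s, smul_smul, Int.cast_mul,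
          mul_comm])
      map_zero' := huniq 0 0 (by rw [ZeroMemClass.coe_zero, map_zero, LinearMap.zero_apply, Int.cast_zero, zero_smul])
      map_add' := fun s s' => huniq (s + s') (lam s + lam s') (by
        rw [Subalgebra.coe_add, map_add, LinearMap.add_apply, hlam s, hlam s', Int.cast_add, add_smul]) }
  have hlamHom : ∀ s, lamHom s = lam s := fun _ => rfl
  let χ : HeckeRing0.primeTo N 2 (3 * N) →+* ZMod 3 := (Int.castRingHom (ZMod 3)).comp lamHom
  have hχ : ∀ s, χ s = ((lam s : ℤ) : ZMod 3) := fun _ => rfl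
  have h𝔫 : (RingHom.ker χ).IsMaximal := RingHom.ker_isMaximal_of_surjective χ (ZMod.ringHom_surjective χ)
  have h3 : (3 : HeckeRing0.primeTo N 2 (3 * N)) ∈ RingHom.ker χ := by
    rw [RingHom.mem_ker, map_ofNat]
    rfl
  -- belonging: `χ(T_r) = a_r(f) = a_r(W) mod 3` at the good primes
  have hbel : ∀ (r : ℕ) (hr : r.Prime) (hrS : ¬ r ∣ 3 * N), ¬ r ∣ W.conductorNorm ℤ * 3 →
      HeckeRing0.primeTo.T N 2 (3 * N) hr hrS - (W.frobeniusTrace r : HeckeRing0.primeTo N 2 (3 * N)) ∈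
        RingHom.ker χ := by
    intro r hr hrS hrW
    haveI : Fact r.Prime := ⟨hr⟩
    haveI : NeZero r := ⟨hr.ne_zero⟩
    have hgood : W.HasGoodReductionAtPrime r := by
      by_contra hbad
      exact hrW ((W.dvd_conductorNorm_iff_not_hasGoodReductionAtPrime r).mpr hbad |>.mul_right 3)
    have hT : lam (HeckeRing0.primeTo.T N 2 (3 * N) hr hrS) = W.frobeniusTrace r := by
      apply huniq
      rw [HeckeRing0.primeTo.coe_T, HeckeRing0.toEnd_T, hf.1.heckeT_eq_coeff_smul hr,
        ← W.LFunction_apply_prime_eq_frobeniusTrace r hgood]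
      exact congrArg (· • f) (hf.2 r)
    rw [RingHom.mem_ker, map_sub, map_intCast, hχ, hT, sub_self]
  obtain ⟨s, hs𝔫, hsur⟩ := h W hirr N 3 (3 * N) Nat.prime_three Nat.prime_three le_rfl (by norm_num) rfl
    (RingHom.ker χ) h𝔫 h3 hbel
  refine ⟨(s : HeckeRing0 N 2), lam s, fun hdvd => hs𝔫 ?_, hlam s, hsur⟩
  rw [RingHom.mem_ker, hχ]
  exact (ZMod.intCast_zmod_eq_zero_iff_dvd (lam s) 3).mpr hdvd

/-- **From the Hecke-cokernel statement to E-es-19's shift classes, per curve.** If `s f = m f` with `3 ∤ m` and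
`s·H₁(X₀(N), ℤ) ⊆ (ι₃^∨ − ι₁^∨) H₁(X₀(3N), ℤ)` (`9 ∣ N`), then `2|m|·Λ_f` lies in the span of the admissible shift
classes of `(W, f)` above any `ℓ₀` (`periodLattice_mul_subset_of_hecke_cokernel`: `mΛ_f ⊆ Λ_{f∣ι₃−f∣ι₁}`;
`two_mul_periodLattice_shiftOldform_le_shiftSpan`: `2Λ_{f∣ι₃−f∣ι₁} ⊆` span) — the instance of the body of
`ShiftClassGenerationThree` for this curve. [folklore] -/
theorem shiftClasses_of_hecke_cokernel (W : WeierstrassCurve ℚ) [W.IsElliptic] {N : ℕ} [NeZero N]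
    (f : CuspForm (Gamma0 N) 2) (h9 : 3 ^ 2 ∣ N) (ℓ₀ : ℕ)
    (H : ∃ (s : HeckeRing0 N 2) (m : ℤ), ¬ (3 : ℤ) ∣ m ∧ HeckeRing0.toEnd N 2 s f = (m : ℂ) • f ∧
      ∀ x ∈ periodHomology N, ∃ z ∈ periodHomology (3 * N),
        (degeneracyMap0 N (3 * N) 3 2).dualMap z - (degeneracyMap0 N (3 * N) 1 2).dualMap z = s • x) :
    ∃ m : ℕ, ¬ 3 ∣ m ∧ ∀ z ∈ periodLattice f,
      (m : ℂ) * z ∈ AddSubgroup.closure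
        {z : ℂ | ∃ ℓ ∈ {ℓ : ℕ | ℓ₀ ≤ ℓ ∧ (ℓ.Prime ∧ ¬ ℓ ∣ N ∧ ℓ % 12 = 11 ∧
            ∀ q ∈ N.primeFactors, ¬ q ^ 2 ∣ N →
              jacobiSym (q : ℤ) ℓ = (if ((q : ℤ) * W.LFunction q) % 3 = 1 then -1 else 1))},
          ∃ a : ℕ, 0 < a ∧ a < ℓ ∧
            z = (modularSymbol f (((3 * a : ℕ) : ℚ) / ℓ) - modularSymbol f 0) -
                (modularSymbol f ((a : ℚ) / ℓ) - modularSymbol f 0)} := by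
  haveI : NeZero (3 * N) := ⟨Nat.mul_ne_zero (by norm_num) (NeZero.ne N)⟩
  obtain ⟨s, m, hm, hs, hsur⟩ := H
  have h9' : 9 ∣ N := by norm_num at h9; exact h9
  have key := periodLattice_mul_subset_of_hecke_cokernel f
    (degeneracyMap0 N (3 * N) 3 2 f - degeneracyMap0 N (3 * N) 1 2 f) s m hs (fun x hx => ?_)
  · refine ⟨2 * m.natAbs, fun h => hm ?_, fun z hz => ?_⟩
    · have h3 : 3 ∣ m.natAbs := (Nat.Prime.dvd_mul Nat.prime_three).mp h |>.resolve_left (by norm_num)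
      exact Int.ofNat_dvd_left.mpr h3
    · have hmz : (m : ℂ) * z ∈ periodLattice (degeneracyMap0 N (3 * N) 3 2 f - degeneracyMap0 N (3 * N) 1 2 f) :=
        key z hz
      have habs : ((m.natAbs : ℕ) : ℂ) * z ∈
          periodLattice (degeneracyMap0 N (3 * N) 3 2 f - degeneracyMap0 N (3 * N) 1 2 f) := by
        rcases Int.natAbs_eq m with hm' | hm'
        · have e : ((m.natAbs : ℕ) : ℤ) = m := by omega
          have : ((m.natAbs : ℕ) : ℂ) = (m : ℂ) := by rw [← Int.cast_natCast, e]
          rw [this]; exact hmz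
        · have e : ((m.natAbs : ℕ) : ℤ) = -m := by omega
          have : ((m.natAbs : ℕ) : ℂ) = -(m : ℂ) := by rw [← Int.cast_natCast, e, Int.cast_neg]
          rw [this, neg_mul]
          exact neg_mem hmz
      have h2 := two_mul_periodLattice_shiftOldform_le_shiftSpan f (epsSign W) (epsSign_eq_one_or W) h9' ℓ₀ habs
      have hmul : ((2 * m.natAbs : ℕ) : ℂ) * z = 2 * (((m.natAbs : ℕ) : ℂ) * z) := by
        push_cast
        ring
      rw [hmul]
      simp only [epsSign] at h2
      exact h2
  · obtain ⟨z, hz, hzs⟩ := hsur x hx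
    refine ⟨z, hz, ?_⟩
    rw [← hzs, LinearMap.sub_apply, map_sub, LinearMap.dualMap_apply, LinearMap.dualMap_apply]

/-- **E-es-19's body for ONE globally minimal curve from the line-facing homological E-es-25** (`p = 3`): the body of
`EsG9Typed.RelativeIharaCokernelOfCurve 3 3 1` (VERBATIM as `h`) gives, for every globally minimal `W` with `W[3]`
irreducible, its newform `f` of level `N` with `9 ∣ N`, and every `ℓ₀`, a multiple `mΛ_f` (`3 ∤ m`) inside the span of
the admissible shift classes above `ℓ₀` — i.e. the conclusion of `ShiftClassGenerationThree` for that `(W, f, ℓ₀)`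
(composition of `exists_hecke_cokernel_three_of_relativeIharaCokernelOfCurve` and `shiftClasses_of_hecke_cokernel`).
The crux `ManinPrimeToThreeAtNine` only ever needs globally minimal `W`. [folklore] -/
theorem shiftClasses_of_relativeIharaCokernelOfCurve
    (h : ∀ (W₀ : WeierstrassCurve ℚ) [W₀.IsElliptic] [W₀.IsGloballyMinimal], W₀.HasIrreducibleModPGaloisRep 3 →
      ∀ (N d L : ℕ) [NeZero N] [NeZero d] [NeZero L], (3 : ℕ).Prime → (3 : ℕ).Prime → 1 ≤ 1 → d = 3 ^ 1 →
        L = d * N →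
        ∀ 𝔫 : Ideal (HeckeRing0.primeTo N 2 (3 * N)), 𝔫.IsMaximal →
          (3 : HeckeRing0.primeTo N 2 (3 * N)) ∈ 𝔫 →
          (∀ (r : ℕ) (hr : r.Prime) (hrS : ¬ r ∣ 3 * N), ¬ r ∣ W₀.conductorNorm ℤ * 3 →
            HeckeRing0.primeTo.T N 2 (3 * N) hr hrS -
              (W₀.frobeniusTrace r : HeckeRing0.primeTo N 2 (3 * N)) ∈ 𝔫) →
          ∃ s : HeckeRing0.primeTo N 2 (3 * N), s ∉ 𝔫 ∧
            ∀ x ∈ periodHomology N, ∃ z ∈ periodHomology L,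
              (degeneracyMap0 N L d 2).dualMap z - (degeneracyMap0 N L 1 2).dualMap z =
                (s : HeckeRing0 N 2) • x)
    (W : WeierstrassCurve ℚ) [W.IsElliptic] [W.IsGloballyMinimal] (hirr : W.HasIrreducibleModPGaloisRep 3)
    {N : ℕ} [NeZero N] (f : CuspForm (Gamma0 N) 2) (hf : IsNewformOf W f) (h9 : 3 ^ 2 ∣ N) (ℓ₀ : ℕ) :
    ∃ m : ℕ, ¬ 3 ∣ m ∧ ∀ z ∈ periodLattice f,
      (m : ℂ) * z ∈ AddSubgroup.closure
        {z : ℂ | ∃ ℓ ∈ {ℓ : ℕ | ℓ₀ ≤ ℓ ∧ (ℓ.Prime ∧ ¬ ℓ ∣ N ∧ ℓ % 12 = 11 ∧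
            ∀ q ∈ N.primeFactors, ¬ q ^ 2 ∣ N →
              jacobiSym (q : ℤ) ℓ = (if ((q : ℤ) * W.LFunction q) % 3 = 1 then -1 else 1))},
          ∃ a : ℕ, 0 < a ∧ a < ℓ ∧
            z = (modularSymbol f (((3 * a : ℕ) : ℚ) / ℓ) - modularSymbol f 0) -
                (modularSymbol f ((a : ℚ) / ℓ) - modularSymbol f 0)} :=
  shiftClasses_of_hecke_cokernel W f h9 ℓ₀ (exists_hecke_cokernel_three_of_relativeIharaCokernelOfCurve h W hirr f hf)

end Summit.BirchSwinnertonDyer.BirchSwinnertonDyer.Theorems.ManinLocalTwoThree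

end
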